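/-
Copyright: b2b-lace packet (CARVER gen 55).  [FvdH17] §5.1 "Elements of the bounds" / App. B Table "definition of
`P^{ι,b}(x,y)`" row `b = 0`: the ENTRY INEQUALITY for the element `(P⃗^ι)_0 = (1/2d)[1 + Σ_ι τ_{3,p}(e_ι)·Σ_x P̃(0 ⇔ x)]`
over the tree objects `vecPiota` (`NobleWeightedBlocks`), its landed closed form `NobleBlocks.vecPiota_zero`
(`NobleElementsClosedForms`), `Letters.perc` (`NoblePercLetters`), `tauGe` (`NobleBoundsN0`) and the landed transfer
form `tsum_perc_pdbc_le_of_sumLE` (`NobleEntryVecPEZero`).  Proofs only; no named fact; no numeral; no dimension.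
-/
import Literature.Probability.FitznerVanDerHofstad2017.NobleEntryVecPEZero
import HarnessLib

/-!
# [FvdH17] §5.1: the entry `(P⃗^ι)_0 ≤ 1/(2d) + τ̄₃ · (1 + ½·Bound[Bubble, 2, M])`

CITATION HEADER (PLACEMENT v2). This module is part of a certified REPRODUCTION of:
R. Fitzner, R. van der Hofstad, *Mean-field behavior for nearest-neighbor percolation in `d > 10`*,
Electron. J. Probab. **22** (2017) no. 43 [FvdH17] (extended version arXiv:1506.07977v2), §5.1 "Elements of the
bounds" (arXiv v2 p. 50: `(P⃗^ι)_b = (1/2d)[δ_{0,b} + Σ_{ι,x,y} P^{ι,b}(x,y)]`), App. B Table "Diagrams and definition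
of `P^{ι,b}(x,y)`" row `b = 0` (v2 p. 73: `τ_{3,p}(e_ι) P(e_ι ⇔ x)`), §4.2 (4.1) (p. 34: `τ_{n,p}` and its lattice
symmetry) and (4.20)–(4.21) (pp. 36–37: the Bubble bound on `Σ_x P(0 ⇔ x)`), §5.4 closing paragraph (v2 p. 56); and of
R. Fitzner, R. van der Hofstad, *Generalized approach to the non-backtracking lace expansion*, Probab. Theory Related
Fields **169** (2017) 1041–1119 [NoBLE17], §5.3.1 (SRW-integral form of the tails).  Origin: build `lace` (host summit
CriticalPhenomena), CARVER seat; node N76-PIOTA0 of the cell's lemma DAG (leaf L4 of the REV15 precondition census: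
the `P⃗^ι` entry producers consumed by the `ι`-families `Ξ^ι`, [FvdH17] (6.x) / notebook `Vector[Piota]`).

WHAT THIS FILE DOES.  `NobleBlocks.vecPiota_zero` is the identity `(P⃗^ι)_0 = (1/2d)·(1 + (Σ_ι τ_{(≥3)}(e_ι))·Σ_x P̃(0 ⇔ x))`
for every letter table.  At `L = Letters.perc d p`: `τ_{(≥3)}(e_ι) = ofReal τ_{3,p}(e_ι) = ofReal τ_{3,p}(e₁)` for each of
the `2d` unit vectors (`perc_tau_ge`, `tauGe_stepVec`), so any real majorant `τ_{3,p}(e₁) ≤ T3` bounds the direction sum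
by `2d·T3`, the factor `1/2d` cancels it, and any genuine `Σ_x 𝓓_{1,1}(x) ≤ B` bounds `Σ_x P̃(0 ⇔ x) ≤ 1 + B`
(`tsum_perc_pdbc_le_of_sumLE`).  Results:

* `invTwoD_eq_ofReal` — `1/(2d)` as `ENNReal.ofReal (1 / (2d))` (`1 ≤ d`);
* `perc_sum_tau_ge_stepVec_le` — `Σ_ι τ_{(≥m)}(e_ι) ≤ 2d · ofReal T` for `τ_{m,p}(e₁) ≤ T`;
* `perc_vecPiota_zero_le_ofReal_of_sumLE` — **the entry inequality in transfer form**: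
  `vecPiota (Letters.perc d p) 0 ≤ ofReal (1/(2d) + T3·(1 + B))` for `1 ≤ d`, `τ_{3,p}(e₁) ≤ T3`, `SumLE 𝓓_{1,1} B`;
* `perc_vecPiota_zero_le_ofReal_printed` — the same with the landed printed Bubble cell
  (`B = halfBubblePrintedR d p Γ₁ Γ₂ 1 M`, i.e. `1 + B = vecPEZeroR d p Γ₁ Γ₂ M`): `5 ≤ d`, `p < p_c`, `(2d−1)p ≤ Γ₁`,
  `f₂(p) ≤ Γ₂`, `2 ≤ M`; and `perc_vecPiotaZero_bound_nonneg` (the consumer's nonnegativity side condition).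

The majorant `T3` of `τ_{3,p}(e₁)` stays a binder (the same interface as `NoblePeelEntryOne.perc_vecPS_one_le_ofReal_of_vecPE`);
its printed producer is the two-point cell of the packet.  Any `d`; nothing landed is modified; no cited hypothesis —
every statement is a kernel-proved inequality between landed definitions.  The authors' notebook computes this entry as
`Bound[Piota,0,s] = 1/(2d) + Bound[G,{1},3,s]·(1 + ½·Bound[Bubble,2,s])` (`Percolation.nb`, the `P^ι` cell); that
identification and every numerical reading are NOT part of this module.
-/

noncomputable section

namespace Literature.Probability.FitznerVanDerHofstad2017

open MeasureTheory Finset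
open scoped BigOperators ENNReal
open Literature.Probability.LatticeModels Literature.Probability.Percolation
open Literature.Barriers.CriticalPhenomena
open Literature.Probability.FitznerVanDerHofstad2017.NobleBlocks

variable {d : ℕ}

/-! ## A. The prefactor and the direction sum -/

/-- `1/(2d) = ofReal (1/(2d))` for `d ≥ 1`. [cite: FitznerVanDerHofstad2017, §5.1 "Elements of the bounds", the prefactor `1/2d` of `P⃗^ι` (arXiv:1506.07977v2 p. 50)] -/
theorem invTwoD_eq_ofReal (hd : 1 ≤ d) : invTwoD d = ENNReal.ofReal (1 / (2 * (d : ℝ))) := by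
  have h2d : (0 : ℝ) < 2 * (d : ℝ) := by
    have : (1 : ℝ) ≤ d := by exact_mod_cast hd
    linarith
  rw [invTwoD, one_div, ENNReal.ofReal_inv_of_pos h2d, ENNReal.ofReal_mul zero_le_two, ENNReal.ofReal_ofNat,
    ENNReal.ofReal_natCast]

/-- **`Σ_ι τ_{(≥m)}(e_ι) ≤ 2d · T`** at the percolation letters, for any real majorant `τ_{m,p}(e₁) ≤ T` (all `2d` unit
vectors carry the same two-point value, `tauGe_stepVec`).
[cite: FitznerVanDerHofstad2017, §4.2 (4.1) (arXiv:1506.07977v2 p. 34); §5.1 "Elements of the bounds" (p. 50)] -/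
theorem perc_sum_tau_ge_stepVec_le (hd : 1 ≤ d) (p : unitInterval) (m : ℕ) {T : ℝ}
    (hT : tauGe d p m (unitSite1 d) ≤ T) :
    ∑ ι : Fin d × Bool, (Letters.perc d p).tau (.ge m) (stepVec ι) ≤ 2 * (d : ℝ≥0∞) * ENNReal.ofReal T := by
  calc ∑ ι : Fin d × Bool, (Letters.perc d p).tau (.ge m) (stepVec ι)
      ≤ ∑ _ι : Fin d × Bool, ENNReal.ofReal T := Finset.sum_le_sum fun ι _ => by
        rw [perc_tau_ge, tauGe_stepVec hd]
        exact ENNReal.ofReal_le_ofReal hT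
    _ = 2 * (d : ℝ≥0∞) * ENNReal.ofReal T := by
        rw [Finset.sum_const, Finset.card_univ, Fintype.card_prod, Fintype.card_fin, Fintype.card_bool, nsmul_eq_mul]
        push_cast
        ring

/-! ## B. The entry inequality for `(P⃗^ι)_0` -/

/-- **TRANSFER FORM: `(P⃗^ι)_0 ≤ 1/(2d) + T3·(1 + B)`** at the percolation letters, for any real majorant
`τ_{3,p}(e₁) ≤ T3` and any genuine bound `Σ_x 𝓓_{1,1}(x) ≤ B` (`d ≥ 1`).
[cite: FitznerVanDerHofstad2017, §5.1 "Elements of the bounds", `P⃗^ι` (arXiv:1506.07977v2 p. 50); App. B Table "definition of P^{ι,b}(x,y)" row b = 0 (p. 73); §4.2 (4.20)–(4.21) (pp. 36–37)] -/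
theorem perc_vecPiota_zero_le_ofReal_of_sumLE (hd : 1 ≤ d) (p : unitInterval) {T3 : ℝ}
    (h3 : tauGe d p 3 (unitSite1 d) ≤ T3) {B : ℝ} (hB : SumLE (diagD d p 1 1) B) :
    vecPiota (Letters.perc d p) 0 ≤ ENNReal.ofReal (1 / (2 * (d : ℝ)) + T3 * (1 + B)) := by
  have hT3 : 0 ≤ T3 := (tauGe_nonneg p 3 _).trans h3
  have hB0 : 0 ≤ B := (tsum_nonneg fun x => diagD_nonneg p 1 1 x).trans hB.2
  have h1B : 0 ≤ 1 + B := by linarith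
  have hd0 : (2 : ℝ≥0∞) * (d : ℝ≥0∞) ≠ 0 := by
    have : (d : ℝ≥0∞) ≠ 0 := by exact_mod_cast (show d ≠ 0 by omega)
    exact mul_ne_zero two_ne_zero this
  have hdT : (2 : ℝ≥0∞) * (d : ℝ≥0∞) ≠ ∞ := ENNReal.mul_ne_top ENNReal.ofNat_ne_top (ENNReal.natCast_ne_top d)
  have hsum := perc_sum_tau_ge_stepVec_le hd p 3 h3
  have hpd := tsum_perc_pdbc_le_of_sumLE p hB
  calc vecPiota (Letters.perc d p) 0
      = invTwoD d * (1 + (∑ ι : Fin d × Bool, (Letters.perc d p).tau (.ge 3) (stepVec ι)) *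
          ∑' x, (Letters.perc d p).pdbc x) := vecPiota_zero _
    _ ≤ invTwoD d * (1 + (2 * (d : ℝ≥0∞) * ENNReal.ofReal T3) * ENNReal.ofReal (1 + B)) := by gcongr
    _ = invTwoD d + invTwoD d * (2 * (d : ℝ≥0∞)) * (ENNReal.ofReal T3 * ENNReal.ofReal (1 + B)) := by ring
    _ = invTwoD d + ENNReal.ofReal T3 * ENNReal.ofReal (1 + B) := by
        rw [invTwoD, ENNReal.inv_mul_cancel hd0 hdT, one_mul]
    _ = ENNReal.ofReal (1 / (2 * (d : ℝ)) + T3 * (1 + B)) := by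
        rw [invTwoD_eq_ofReal hd, ← ENNReal.ofReal_mul hT3,
          ENNReal.ofReal_add (by positivity) (mul_nonneg hT3 h1B)]

/-- **ENTRY INEQUALITY for `(P⃗^ι)_0` with the printed Bubble cell**: for `5 ≤ d`, `p < p_c`, `(2d−1)p ≤ Γ₁`,
`f₂(p) ≤ Γ₂`, `2 ≤ M` and any real majorant `τ_{3,p}(e₁) ≤ T3`,
`vecPiota (Letters.perc d p) 0 ≤ ofReal (1/(2d) + T3 · vecPEZeroR d p Γ₁ Γ₂ M)` (`vecPEZeroR = 1 + ½·Bound[Bubble, 2, M]`,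
the landed `(P⃗^E)_0` majorant of `NobleEntryVecPEZero`).
[cite: FitznerVanDerHofstad2017, §5.1 "Elements of the bounds", `P⃗^ι` (arXiv:1506.07977v2 p. 50); App. B Table "definition of P^{ι,b}(x,y)" row b = 0 (p. 73); §5.4 closing paragraph (p. 56); §4.2 (4.20)–(4.21) (pp. 36–37)]
[cite: FitznerVanDerHofstad2016NoBLE, §5.3.1 and (5.13) (PTRF 169 (2017) pp. 1091, 1096–1097)] -/
theorem perc_vecPiota_zero_le_ofReal_printed (hd : 5 ≤ d) (p : unitInterval) (hp : p < criticalProbI d) {Γ₁ Γ₂ : ℝ}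
    (hΓ1 : (2 * d - 1) * (p : ℝ) ≤ Γ₁) (hΓ2 : nobleF2 d p ≤ Γ₂) {M : ℕ} (hM : 2 ≤ M) {T3 : ℝ}
    (h3 : tauGe d p 3 (unitSite1 d) ≤ T3) :
    vecPiota (Letters.perc d p) 0 ≤ ENNReal.ofReal (1 / (2 * (d : ℝ)) + T3 * vecPEZeroR d p Γ₁ Γ₂ M) :=
  perc_vecPiota_zero_le_ofReal_of_sumLE (by omega) p h3
    (sumLE_diagD_halfBubblePrintedR hd p hp (n := 1) le_rfl (by simpa using hM) hΓ1 hΓ2)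

/-- `0 ≤ 1/(2d) + T3 · vecPEZeroR d p Γ₁ Γ₂ M` under the cell's hypotheses (the consumer's nonnegativity side condition).
[cite: FitznerVanDerHofstad2017, §5.1 "Elements of the bounds", `P⃗^ι` (arXiv:1506.07977v2 p. 50)] -/
theorem perc_vecPiotaZero_bound_nonneg (hd : 5 ≤ d) (p : unitInterval) (hp : p < criticalProbI d) {Γ₁ Γ₂ : ℝ}
    (hΓ1 : (2 * d - 1) * (p : ℝ) ≤ Γ₁) (hΓ2 : nobleF2 d p ≤ Γ₂) {M : ℕ} (hM : 2 ≤ M) {T3 : ℝ}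
    (h3 : tauGe d p 3 (unitSite1 d) ≤ T3) :
    0 ≤ 1 / (2 * (d : ℝ)) + T3 * vecPEZeroR d p Γ₁ Γ₂ M :=
  add_nonneg (by positivity)
    (mul_nonneg ((tauGe_nonneg p 3 _).trans h3) (vecPEZeroR_nonneg hd p hp hΓ1 hΓ2 hM))

end Literature.Probability.FitznerVanDerHofstad2017

end
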